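import Summits.NavierStokesRegularity.NavierStokesRegularity.Theorems.ScenarioCensusRowF1Stretched
import HarnessLib

/-!
# LINE «stretched-top» port, part 2/4: the singular Type-I zoom package with gradients and the scale identity; two Liouville theorems in `𝒦_C`

Re-homed for the scenario census (typer seat ns-census-typer-1 g7; the cells F1sx ⊇ F1ss ⊇ F1rg, F1gsx, F1lb are MEMBERS OF RECORD «DECIDED IN KERNEL IN
FILES» of row F1 since census v1.68 (critic idea-crit-3 g6 PASS 19:59:58Z; ref ns-census-ref g8 PRE-CHECK ✓ §13.14 [2/6]; lit §21.20); this port makes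
them TREE-decided): VERBATIM PORT of ns-idea-3 LINE 16 «stretched-top», `pub/ideators/ns-idea-3/lines/stretched-top/line-stretched-top.lean` sha16
a94533c1db73adac (912 l., lean check rc 0, 0 sorry), split for the 400-line rule into `ScenarioCensusRowF1Stretched` (§1) → `…StretchedZoom` (§2–§3) →
`…StretchedTransfer` (§4) → `…StretchedTop` (§5 + census KEYS).  Lean text VERBATIM in namespace `…Theorems.ScenarioCensus.StretchedTop` (the line's
`…Cruxes.ScenarioCensusRowF1.StretchedTopLine` re-homed); port edits: `@[conjecture]` on the residual `StretchingSlack` (≡ `ScenarioCensus.Row_F1`, OPEN).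

No census VALUE is moved here (row F1 stays OPEN-WITH-LINE; the members become TREE-decided by name); NS regularity is NOT proved; `Row_F1` is
untouched (zero movement, `stretchingSlack_iff_rowF1`); no summit statement is proved by this file.
-/

-- the summit and its single problem share the name `NavierStokesRegularity` (D-0017 nested layout)
set_option linter.dupNamespace false

noncomputable section

open MeasureTheory Set Function Filter TopologicalSpace Metric
open scoped Topology NNReal ENNReal InnerProductSpace RealInnerProductSpace Laplacian

namespace Summit.NavierStokesRegularity.NavierStokesRegularity.Theorems.ScenarioCensus.StretchedTop

open Literature.Analysis Literature.Analysis.FluidPDE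
open Summit.NavierStokesRegularity.NavierStokesRegularity.Theorems

/-! ## §2 The singular Type-I zoom package with gradients and the scale identity `α R = β` -/

/-- **The singular Type-I zoom package, with gradients and the scale identity** at a backward-singular
final-time point `(T, x₀)` of a Type-I Clay solution: positive constants `α, β, R` with `α R = β`, positive
scales `c_j → 0` and a NONTRIVIAL element `W ∈ 𝒦_C` such that the zooms
`(c_j α) u(T + c_j² β t, x₀ + c_j R y)` converge to `W(t, y)` AND their gradients
`(c_j α)(c_j R) ∇u(T + c_j² β t, x₀ + c_j R y)` converge to `∇W(t, y)` at every point of the open past.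
The identity `α R = β` (`α = R/ν`, `β = R²/ν` in `exists_zoom_typeIBound_lt_top_of_morrey`) says that the
gradient weight `c_j² α R` equals the time weight `(T − τ_j)/(−t) = c_j² β`: the dimensionless gradient
`(T − t) ∇u` is zoom-invariant. (refs: AlbrittonBarker2019, §3; KochNadirashviliSereginSverak2009, Lemma 6.1) -/
theorem exists_singularZoom_package {ν T : ℝ} (hν : 0 < ν) (hT : 0 < T)
    {u : ℝ → E3 → E3} {p : ℝ → E3 → ℝ}
    (hsol : IsClassicalNSSolutionOn (Ico 0 T) ν 0 u p) (hLH : IsLerayHopfOn T ν 0 (u 0) u)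
    (hdec : HasRapidSpatialDecay (u 0)) (hTI : IsTypeIBlowup u T) (x₀ : E3)
    (hsing : ∀ r : ℝ, 0 < r →
      eLpNorm (uncurry u) ∞ (volume.restrict (parabolicCylinder r ((T : ℝ), x₀))) = ∞) :
    ∃ (C α β R : ℝ) (c : ℕ → ℝ) (W : ℝ → E3 → E3),
      0 < α ∧ 0 < β ∧ 0 < R ∧ α * R = β ∧ (∀ j, 0 < c j) ∧ Tendsto c atTop (𝓝 0) ∧
      IsTypeIAncientMild C W ∧
      (∀ t < 0, ∀ y : E3,
        Tendsto (fun j => (c j * α) • u (T + c j ^ 2 * β * t) (x₀ + (c j * R) • y)) atTop (𝓝 (W t y))) ∧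
      (∀ t < 0, ∀ y : E3,
        Tendsto (fun j => (c j * α * (c j * R)) • fderiv ℝ (u (T + c j ^ 2 * β * t)) (x₀ + (c j * R) • y))
          atTop (𝓝 (fderiv ℝ (W t) y))) ∧
      ∃ t < 0, ∃ y, W t y ≠ 0 := by
  -- ## (1) the Type-I rate window, the Morrey bound and the unit zoom at `(T, x₀)`
  obtain ⟨C, δ, -, hδ, hδT, hrate⟩ := exists_typeI_rate_window hT hTI
  obtain ⟨r₀, M₀, T₁, hr₀, hT₁, hMor⟩ := morrey_of_typeI hν hT hsol hLH hTI
  obtain ⟨R, α, β, hR, hα, hβ, hβeq, hαeq, hβT, hball, hGv, htypeI⟩ :=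
    exists_zoom_typeIBound_lt_top_of_morrey hν hT hsol hLH hr₀ hT₁ hMor x₀
  have hαR : α * R = β := by
    rw [hαeq, hβeq]
    ring
  set v : ℝ → E3 → E3 := α • stPull β R T x₀ u with hv
  set πv : ℝ → E3 → ℝ :=
    α ^ 2 • stPull β R T x₀ (fun t x => p t x - (p t 0 - normalisedPressure (u t) 0)) with hπv
  set Gv : ℝ → E3 → E3 →L[ℝ] E3 :=
    (α * R) • stPull β R T x₀ (fun t x => fderiv ℝ (u t) x) with hGvdef
  set I₀ : ℝ≥0∞ := typeIBound (parabolicCylinder (1 / 2) (0 : ℝ × E3)) v πv Gv with hI₀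
  have hI₀top : I₀ ≠ ⊤ := htypeI.ne
  -- ## (2) the scales `c k = 1/(k+4) ↓ 0` and the zoom sequence
  set c : ℕ → ℝ := fun k => 1 / ((k : ℝ) + 4) with hc
  have hcpos : ∀ k, 0 < c k := fun k => by simp only [hc]; positivity
  have hc4 : ∀ k, c k ≤ 1 / 4 := fun k =>
    div_le_div_of_nonneg_left zero_le_one (by norm_num) (by linarith [(Nat.cast_nonneg k : (0 : ℝ) ≤ k)])
  have hc2 : ∀ k, c k ≤ 1 / 2 := fun k => (hc4 k).trans (by norm_num)
  have hclim : Tendsto c atTop (𝓝 0) :=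
    tendsto_const_nhds.div_atTop (tendsto_atTop_add_const_right _ _ tendsto_natCast_atTop_atTop)
  set w : ℕ → ℝ → E3 → E3 :=
    fun k => (c k * α) • stPull (c k ^ 2 * β) (c k * R) T x₀ u with hw
  -- the final windows `(Aw k, 0)`, `Aw k → -∞`
  set Aw : ℕ → ℝ := fun k => -(δ / (c k ^ 2 * β)) with hA
  have hAk : ∀ k, Aw k = -(δ / β * ((k : ℝ) + 4) ^ 2) := by
    intro k
    simp only [hA, hc]
    field_simp
  have hAlim : Tendsto Aw atTop atBot := by
    have h1 : Tendsto (fun k : ℕ => ((k : ℝ) + 4) ^ 2) atTop atTop :=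
      (tendsto_pow_atTop two_ne_zero).comp
        (tendsto_atTop_add_const_right _ _ tendsto_natCast_atTop_atTop)
    have h2 : Tendsto (fun k : ℕ => δ / β * ((k : ℝ) + 4) ^ 2) atTop atTop :=
      h1.const_mul_atTop (by positivity)
    refine (tendsto_neg_atTop_atBot.comp h2).congr fun k => ?_
    rw [hAk k]
    rfl
  -- ## (3) per-scale facts
  have hcW : ∀ k, ContinuousOn (uncurry (w k)) (Ioo (Aw k) 0 ×ˢ univ) := fun k =>
    zoom_continuousOn hν hsol hR hαeq hβeq (hcpos k) hδT
  have hdivW : ∀ k, ∀ t ∈ Ioo (Aw k) 0, IsWeaklyDivFree (w k t) := fun k t ht =>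
    zoom_isWeaklyDivFree hν hsol hR hαeq hβeq (hcpos k) hδT ht
  have hmildW : ∀ k, ∀ s t : ℝ, Aw k < s → s < t → t < 0 → ∀ y,
      w k t y = UnboundedOperators.heatExtension (w k s) (t - s) y -
        oseenDuhamel 1 s (w k) (w k) t y := fun k s t hs hst ht y =>
    zoom_oseen hν hT hsol hLH hdec hR hαeq hβeq (hcpos k) hδT hs hst ht y
  set C₁ : ℝ := α * C / Real.sqrt β with hC₁
  have hIW : ∀ k, ∀ t ∈ Ioo (Aw k) 0, ∀ y, ‖w k t y‖ ≤ C₁ / Real.sqrt (-t) := fun k t ht y =>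
    zoom_norm_le hR hαeq hβeq hν (hcpos k) hδT hrate ht y
  -- ## (4) extraction of the `C¹_loc` limit `W ∈ 𝒦_{C₁}` (values AND gradients converge pointwise)
  obtain ⟨φ, hφ, W, hWclass, hpt, hgrad, -, -⟩ :=
    exists_tendsto_of_typeI_seq_Ioo C₁ hAlim hcW hdivW hmildW hIW
  have hφt : Tendsto φ atTop atTop := hφ.tendsto_atTop
  have hcφ : Tendsto (fun j => c (φ j)) atTop (𝓝 0) := hclim.comp hφt
  -- ## (5) `W` is unbounded at the origin
  have hsingW : ∀ r > 0, ∀ M : ℝ, ∃ t ∈ Ioo (-(r ^ 2)) (0 : ℝ),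
      ∃ x ∈ ball (0 : E3) r, M < ‖W t x‖ :=
    zoomSeq_unbounded_at_origin (πv := πv) hsol hR hα hβ hβT hsing hball hGv hI₀top
      (fun j => hcpos (φ j)) (fun j => hc2 (φ j)) fun z hz =>
        hpt z.1 ((SuitableCompactness.mem_parabolicCylinder_zero.1 hz).1.2) z.2
  have hwu : ∀ (j : ℕ) (t : ℝ) (y : E3),
      w (φ j) t y = (c (φ j) * α) • u (T + c (φ j) ^ 2 * β * t) (x₀ + (c (φ j) * R) • y) :=
    fun j t y => by simp only [hw, smul_stPull_apply]
  have hwD : ∀ (j : ℕ) (t : ℝ) (y : E3),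
      fderiv ℝ (w (φ j) t) y = (c (φ j) * α * (c (φ j) * R)) •
        fderiv ℝ (u (T + c (φ j) ^ 2 * β * t)) (x₀ + (c (φ j) * R) • y) := by
    intro j t y
    have e1 : w (φ j) t = (c (φ j) * α) • stPull (c (φ j) ^ 2 * β) (c (φ j) * R) T x₀ u t := by
      simp only [hw, Pi.smul_apply]
    rw [e1, fderiv_const_smul_field, Pi.smul_apply, fderiv_stPull, smul_smul]
  -- ## (6) package
  obtain ⟨ts, hts, xs, -, hM⟩ := hsingW 1 one_pos 0
  have hne : W ts xs ≠ 0 := by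
    intro h0; rw [h0, norm_zero] at hM; exact lt_irrefl _ hM
  exact ⟨C₁, α, β, R, fun j => c (φ j), W, hα, hβ, hR, hαR, fun j => hcpos _, hcφ, hWclass,
    fun t ht y => (hpt t ht y).congr fun j => hwu j t y,
    fun t ht y => (hgrad t ht y).congr fun j => hwD j t y, ts, hts.2, xs, hne⟩

/-! ## §3 Two Liouville theorems in `𝒦_C`: sub-critical vortex stretching (certificate), vanishing Lamb vector -/

/-- The certificate inequality of the constant weight `h ≡ 1`, margin `1 − θ`, from the stretching bound in
the vorticity direction: if `(−s) ⟪L ω, ω⟫ ≤ θ ‖ω‖²`, `ω ≠ 0`, `ξ = ‖ω‖⁻¹ ω`, then for every `F ≥ 0`,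
`((−s)(⟪L ξ, ξ⟫ − F) − 1 + (1 − θ)) · 1 ≤ (−s)(0 + 0 − 0)`. -/
theorem cert_ineq_of_stretching {s θ : ℝ} (hs : s < 0) {L : E3 →L[ℝ] E3} {ω ξ : E3} (hω : ω ≠ 0)
    (hξ : ξ = ‖ω‖⁻¹ • ω) (hL : (-s) * ⟪L ω, ω⟫_ℝ ≤ θ * ‖ω‖ ^ 2) {F : ℝ} (hF : 0 ≤ F) :
    ((-s) * (⟪L ξ, ξ⟫_ℝ - F) - 1 + (1 - θ)) * (1 : ℝ) ≤ (-s) * ((0 : ℝ) + 0 - 0) := by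
  have hs0 : 0 < -s := neg_pos.2 hs
  have hn : 0 < ‖ω‖ := norm_pos_iff.2 hω
  have h1 : ⟪L ξ, ξ⟫_ℝ = ‖ω‖⁻¹ * ‖ω‖⁻¹ * ⟪L ω, ω⟫_ℝ := by
    rw [hξ, map_smul, real_inner_smul_left, real_inner_smul_right]
    ring
  have h2 : (-s) * ⟪L ξ, ξ⟫_ℝ ≤ θ := by
    rw [h1]
    have e : ‖ω‖⁻¹ * ‖ω‖⁻¹ * (θ * ‖ω‖ ^ 2) = θ := by
      field_simp
    calc (-s) * (‖ω‖⁻¹ * ‖ω‖⁻¹ * ⟪L ω, ω⟫_ℝ) = ‖ω‖⁻¹ * ‖ω‖⁻¹ * ((-s) * ⟪L ω, ω⟫_ℝ) := by ring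
      _ ≤ ‖ω‖⁻¹ * ‖ω‖⁻¹ * (θ * ‖ω‖ ^ 2) := mul_le_mul_of_nonneg_left hL (by positivity)
      _ = θ := e
  nlinarith [mul_nonneg hs0.le hF]

/-- **Liouville theorem 1 (sub-critical vortex stretching in `𝒦_C`)**: a Type-I ancient mild field `V`
(KNSS gauge, any constant `C`) with `(−s) ⟪∇V(s,y) ω, ω⟫ ≤ θ ‖ω‖²` (`ω = curl V(s, y)`) for all `s < 0`,
`y` and some `θ < 1` vanishes: `h ≡ 1`, `δ = 1 − θ`, `A = 0` is a stretching certificate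
(`cert_ineq_of_stretching`; only points with `ω ≠ 0` and the direction `ξ_ω` enter), hence `curl V ≡ 0`
(`stretchCert_curl_eq_zero`), the slices are constant (`eq_of_curl_eq_zero_of_isDivFree_of_bounded`) and the
gauge kills them (`IsTypeIAncientMild.eq_zero_of_slice_const`).
(refs: KochNadirashviliSereginSverak2009, Lemma 3.1 and Remark 6.1 (arXiv:0709.3599)) -/
theorem typeI_ancient_eq_zero_of_subcriticalStretching {C θ : ℝ} (hθ : θ < 1)
    {V : ℝ → E3 → E3} (hV : IsTypeIAncientMild C V)
    (hσ : ∀ s < 0, ∀ y : E3,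
      (-s) * ⟪fderiv ℝ (V s) y (curl (V s) y), curl (V s) y⟫_ℝ ≤ θ * ‖curl (V s) y‖ ^ 2) :
    ∀ t < 0, ∀ x, V t x = 0 := by
  intro t ht x
  have hh : IsSmoothSpaceTimeOn (Iio 0) (fun (_ : ℝ) (_ : E3) => (1 : ℝ)) := contDiffOn_const
  have hh1 : ∀ s < (0 : ℝ), ∀ (y : E3), 1 ≤ (fun (_ : ℝ) (_ : E3) => (1 : ℝ)) s y := fun _ _ _ => le_rfl
  have hgrad1 : ∀ s < (0 : ℝ), ∀ (y : E3),
      ‖fderiv ℝ ((fun (_ : ℝ) (_ : E3) => (1 : ℝ)) s) y‖ ≤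
        0 * (1 / Real.sqrt (-s) + ‖y‖ / (-s)) * (fun (_ : ℝ) (_ : E3) => (1 : ℝ)) s y := by
    intro s _ y
    simp
  have hcert : ∀ s < (0 : ℝ), ∀ (y : E3), curl (V s) y ≠ 0 →
      ((-s) * (⟪fderiv ℝ (V s) y (vorticityDirection (curl (V s)) y),
          vorticityDirection (curl (V s)) y⟫_ℝ
          - frobeniusNormSq (fderiv ℝ (vorticityDirection (curl (V s))) y)) - 1 + (1 - θ)) *
          (fun (_ : ℝ) (_ : E3) => (1 : ℝ)) s y ≤
        (-s) * (timeDeriv (fun (_ : ℝ) (_ : E3) => (1 : ℝ)) s y +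
          fderiv ℝ ((fun (_ : ℝ) (_ : E3) => (1 : ℝ)) s) y (V s y) -
          (Δ ((fun (_ : ℝ) (_ : E3) => (1 : ℝ)) s)) y) := by
    intro s hs y hω
    have htd : timeDeriv (fun (_ : ℝ) (_ : E3) => (1 : ℝ)) s y = 0 := by
      simp [timeDeriv]
    have hfd : fderiv ℝ ((fun (_ : ℝ) (_ : E3) => (1 : ℝ)) s) y (V s y) = 0 := by
      simp
    have hΔ : (Δ ((fun (_ : ℝ) (_ : E3) => (1 : ℝ)) s)) y = 0 :=
      laplacian_const_eq_zero (1 : ℝ) y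
    rw [htd, hfd, hΔ]
    exact cert_ineq_of_stretching hs hω (vorticityDirection_apply _ _) (hσ s hs y)
      (frobeniusNormSq_nonneg _)
  have hω : ∀ s < 0, ∀ y, curl (V s) y = 0 := fun s hs y =>
    stretchCert_curl_eq_zero hV hh hh1 (by linarith : (0 : ℝ) < 1 - θ) hgrad1 hcert hs y
  have hub : ∀ s < 0, ∀ y, V s y = V s 0 := fun s hs y =>
    eq_of_curl_eq_zero_of_isDivFree_of_bounded ((hV.contDiff_slice hs).of_le (by norm_cast))
      (hω s hs) (hV.isDivFree hs) (fun z => hV.norm_le hs z) y 0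
  exact hV.eq_zero_of_slice_const hub ht x

/-- The curl of the zero field vanishes. -/
theorem curl_zero_field (x : E3) : curl (fun _ : E3 => (0 : E3)) x = 0 := by
  rw [curl_eq_curlCLM, fderiv_const_apply, map_zero]

/-- **Liouville theorem 2 (vanishing Lamb vector in `𝒦_C`)**: an element of `𝒦_C` whose Lamb vector
`curl V(t) × V(t)` vanishes identically vanishes (the tree's threshold-free generalised-Beltrami theorem
`SimilarityEnstrophy.typeI_ancient_eq_zero_of_generalisedBeltrami`, T33, applied to the curl of `0`). -/
theorem typeI_ancient_eq_zero_of_lamb_eq_zero {C : ℝ} {V : ℝ → E3 → E3} (hV : IsTypeIAncientMild C V)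
    (hL : ∀ t < 0, ∀ y : E3, cross (curl (V t) y) (V t y) = 0) : ∀ t < 0, ∀ x, V t x = 0 := by
  refine SimilarityEnstrophy.typeI_ancient_eq_zero_of_generalisedBeltrami hV fun t ht x => ?_
  have hfun : (fun y => cross (curl (V t) y) (V t y)) = fun _ => (0 : E3) := funext (hL t ht)
  rw [hfun]
  exact curl_zero_field x

end Summit.NavierStokesRegularity.NavierStokesRegularity.Theorems.ScenarioCensus.StretchedTop

end
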